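import Summits.Langlands.Langlands.Theorems.SoloInformedGLOneGeneralField
import Literature.NumberTheory.PAdicHodge.EisensteinRootWittExists
import HarnessLib

/-!
# SoloInformedGLOneUnconditional — hypothesis (H) discharged: Tate's theorem for rank one over every
# `p`-adic field, rank-one Fontaine–Mazur over every number field, and the R3⁺-repaired `GL₁` summit
# conjunct over every number field with a real place — all unconditional
# (solo-Langlands-informed s113, Stage E2.12 payoff)

Stage D (`SoloInformedFontaineMazurGL1General`, `SoloInformedGLOneGeneralField`) proved everything below
granting the Lubin–Tate conjugate-admissibility fact
(H) `LubinTateCharacterConjugateAdmissible F ℓ hF hπ` — the non-identity `ℚ_ℓ`-conjugates `e ∘ χ_π` of a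
Lubin–Tate character of `F` are `ℂ_F`-admissible on an open subgroup (Serre 1968, III.A.4–A.5).  Stage E
(Literature files `UnramifiedResidueFieldEmbedding`, `UnramifiedWittEmbeddingClassification`,
`LubinTateCharacterConjugatesGeneral`, `EisensteinRootWittExists`) PROVES (H) for every `p`-adic field:
the `ℚ_p`-embeddings of `F` restricted to `W(k_F)` are Frobenius twists (`exists_algHom_eq_twistCoeff`),
the twisted Witt/`𝔸_inf` eigenvectors give the periods, and `𝒪_F = W(k_F)[π]` for every uniformizer
(`exists_eisensteinRootW`), whence `lubinTateCharacterConjugateAdmissible_holds`.  Feeding it in: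

* `lubinTateCharacterConjugateAdmissible_all` — (H) in the exact binder shape of the Stage-D theorems;
* ★ `exists_isOpen_eq_prod_of_isDeRhamFramed_all` — **Tate's theorem "de Rham ⇒ locally algebraic" for
  rank-one `p`-adic representations of `Γ_F`, `F/ℚ_p` finite of ANY degree**, unconditionally;
* ★★★ `existsHeckeCharacter_of_isDeRhamFramed_holds` — **the tree's named fact
  `FramedGaloisRep.exists_heckeCharacter_of_isDeRhamFramed` (rank-one Fontaine–Mazur: a continuous
  `ρ : Γ_K → GL₁(ℚ̄_ℓ)` de Rham above `ℓ` comes from an algebraic Hecke character) is a THEOREM**, for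
  every number field `K` and every prime `ℓ`; `fontaineMazurOne` — the pinned-datum form `ρ = r_{θ,ι}`;
* ★★★★ `globalLanglandsCorrespondenceGLnR3plus_one_of_isReal` / `…_of_odd_finrank` — **the R3⁺-repaired
  `GL₁` reciprocity conjunct `R3plus.GlobalLanglandsCorrespondenceGLnR3plus 1 K 𝓡 hcpt` holds for every
  number field `K` with a real place (in particular every `K` of odd degree, e.g. `ℚ` and every cubic
  field), every reciprocity datum `𝓡` and every compactness witness `hcpt`** — no hypotheses left.

(For totally complex `K` the conjunct as typed is obstructed by parallel weights — see
`SoloInformedGLOneRealPlace`; `n ≥ 2` is untouched.)  Plain theorems; no definitions.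

Citations: [SerreAbelianLadic1968] Ch. III §2.3 Thm. 2, App. A.4–A.7; [Tate1967] §3.3;
[SerreLocalFields1979] Ch. II §5 Thm. 4, Ch. I §6 Prop. 18; [FontaineAsterisque223III] Exp. II–III;
[FontaineMazurGeometric1995] Conj. 1; [Patrikis2019] Prop. 2.2.1; [BuzzardGeeLMS2014] Conj. 3.2.1–3.2.2.
-/

noncomputable section
open scoped MatrixGroups Matrix Classical NumberField
open NumberField IsDedekindDomain Field Filter ValuativeRel
open Literature.NumberTheory.Automorphic Literature.NumberTheory.GaloisRepresentations
open Literature.NumberTheory.PAdicHodge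

namespace Summit.Langlands.Langlands.Theorems

namespace GLOneRigidity

/-- **(H) holds**: for every `ℓ`-adic field `F`, every prime `ℓ` with `|ℓ|_F < 1` and every uniformizer `π`,
the `ℚ_ℓ`-conjugates of the Lubin–Tate character `χ_π` are `ℂ_F`-admissible on an open subgroup — in the
binder shape `hH` of the Stage-D theorems. [cite: SerreAbelianLadic1968, Ch. III §A.4–A.5]
[cite: SerreLocalFields1979, Ch. II §5 Thm. 4] [cite: FontaineAsterisque223III, Exp. III §3] -/
theorem lubinTateCharacterConjugateAdmissible_all :
    ∀ (F : Type) [Field F] [ValuativeRel F] [TopologicalSpace F] [IsNonarchimedeanLocalField F]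
      [CharZero F] (ℓ : ℕ) [Fact ℓ.Prime] (hF : valuation F ℓ < 1) (π : 𝒪[F])
      (hπ : (valuation F).IsUniformizer (π : F)), LubinTateCharacterConjugateAdmissible F ℓ hF hπ :=
  fun _ _ _ _ _ _ _ _ hF _ hπ => lubinTateCharacterConjugateAdmissible_holds hF hπ

/-- ★ **Tate's theorem (de Rham ⇒ locally algebraic) for rank one over EVERY `p`-adic field `F`**,
unconditionally: a rank-one de Rham `r : Γ_F → GL₁(ℚ̄_p)` agrees on an open subgroup of inertia with a
product of integral powers of the continuous embeddings `F → ℚ̄_p` composed with the Artin map.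
[cite: SerreAbelianLadic1968, Ch. III §A.5–A.7] [cite: Tate1967, §3.3 Thm. 2 and Cor. 2]
[cite: FontaineAsterisque223III, Exp. III §1.5] -/
theorem exists_isOpen_eq_prod_of_isDeRhamFramed_all
    {F : Type} [Field F] [ValuativeRel F] [TopologicalSpace F] [IsNonarchimedeanLocalField F]
    [CharZero F] {p : ℕ} [Fact p.Prime] (hp : valuation F p < 1)
    {π : 𝒪[F]} (hπ : (valuation F).IsUniformizer (π : F))
    (r : FramedRep (absoluteGaloisGroup F) (PadicAlgCl p) 1)
    (hr : (fontainePst F p hp).IsDeRhamFramed r) :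
    ∃ V : Subgroup Fˣ, IsOpen (V : Set Fˣ) ∧
      ∃ (s : Finset (F →+* PadicAlgCl p)) (n : (F →+* PadicAlgCl p) → ℤ),
        (∀ e ∈ s, Continuous e) ∧ ∀ w ∈ WeilGroup.inertia F, canonicalArtin F w ∈ V →
          ((r (WeilGroup.toAbsGalois F w) : GL (Fin 1) (PadicAlgCl p)) :
              Matrix (Fin 1) (Fin 1) (PadicAlgCl p)) 0 0 =
            ∏ e ∈ s, e ((canonicalArtin F w : Fˣ) : F) ^ n e :=
  exists_isOpen_eq_prod_of_isDeRhamFramed_general hp hπ (lubinTateCharacterConjugateAdmissible_holds hp hπ) r hr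

/-- ★★★ **Rank-one Fontaine–Mazur for every number field, unconditionally**: the tree's named fact
`FramedGaloisRep.exists_heckeCharacter_of_isDeRhamFramed` (a continuous `ρ : Γ_K → GL₁(ℚ̄_ℓ)` de Rham at
every `v ∣ ℓ` comes from an algebraic Hecke character of `K`) is a theorem.
[cite: SerreAbelianLadic1968, Ch. III §2.3 Thm. 2 and App. A.5–A.7] [cite: Tate1967, §3.3]
[cite: Patrikis2019, Prop. 2.2.1] -/
theorem existsHeckeCharacter_of_isDeRhamFramed_holds :
    FramedGaloisRep.exists_heckeCharacter_of_isDeRhamFramed :=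
  existsHeckeCharacter_of_lubinTate lubinTateCharacterConjugateAdmissible_all

section GeneralField

variable {K : Type} [Field K] [NumberField K] {hcpt : isCompact_glFiniteIntegralLevel 1 K}

/-- ★★★ **Rank-one Fontaine–Mazur over every number field `K` (pinned datum), unconditionally**: a
continuous `ρ : Γ_K → GL₁(ℚ̄_ℓ)` de Rham at every `v ∣ ℓ` is Weil's `r_{θ,ι}` for an algebraic Hecke
character `θ` of `K`. [cite: FontaineMazurGeometric1995, Conj. 1] [cite: Patrikis2019, Prop. 2.2.1]
[cite: SerreAbelianLadic1968, Ch. III §2.3 Thm. 2 and App. A] -/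
theorem fontaineMazurOne (𝓡 : ReciprocityData K) {ℓ : ℕ} [Fact ℓ.Prime]
    (ι : PadicAlgCl ℓ ≃+* ℂ) (ρ : FramedGaloisRep K (PadicAlgCl ℓ) 1)
    (hdR : ∀ (v : HeightOneSpectrum (𝓞 K)) (hv : ((ℓ : ℕ) : 𝓞 K) ∈ v.asIdeal),
      (𝓡.pst ℓ v hv).IsDeRhamFramed (ρ.toLocal v)) :
    ∃ (θ : HeckeCharacter K) (p q : InfinitePlace K → ℤ) (hinf : θ.HasInfinityType p q)
      (T : Finset (HeightOneSpectrum (𝓞 K))) (e : HeightOneSpectrum (𝓞 K) → ℕ)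
      (hmod : HeckeCharacter.IsModulus θ T e), ρ = hinf.weilRep hmod ι :=
  fontaineMazurOne_of_lubinTate lubinTateCharacterConjugateAdmissible_all 𝓡 ι ρ hdR

/-- ★★★★ **The R3⁺-repaired `GL₁` reciprocity conjunct holds over every number field with a real place,
unconditionally** — for every reciprocity datum and every compactness witness.
[cite: BuzzardGeeLMS2014, Conj. 3.2.1–3.2.2] [cite: FontaineMazurGeometric1995, Conj. 1]
[cite: SerreAbelianLadic1968, Ch. III §2.3 Thm. 2 and App. A.5–A.7] -/
theorem globalLanglandsCorrespondenceGLnR3plus_one_of_isReal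
    {w : InfinitePlace K} (hw : w.IsReal) (𝓡 : ReciprocityData K) :
    R3plus.GlobalLanglandsCorrespondenceGLnR3plus 1 K 𝓡 hcpt :=
  globalLanglandsCorrespondenceGLnR3plus_one_of_isReal_of_lubinTate lubinTateCharacterConjugateAdmissible_all hw 𝓡

/-- ★★★★ **The R3⁺-repaired `GL₁` reciprocity conjunct holds over every number field of odd degree,
unconditionally.** [cite: BuzzardGeeLMS2014, Conj. 3.2.1–3.2.2] [cite: FontaineMazurGeometric1995, Conj. 1]
[cite: SerreAbelianLadic1968, Ch. III App. A.5–A.7] -/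
theorem globalLanglandsCorrespondenceGLnR3plus_one_of_odd_finrank
    (hodd : Odd (Module.finrank ℚ K)) (𝓡 : ReciprocityData K) :
    R3plus.GlobalLanglandsCorrespondenceGLnR3plus 1 K 𝓡 hcpt :=
  globalLanglandsCorrespondenceGLnR3plus_one_of_odd_finrank_of_lubinTate
    lubinTateCharacterConjugateAdmissible_all hodd 𝓡

end GeneralField

end GLOneRigidity

end Summit.Langlands.Langlands.Theorems

end
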